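import Summits.FinalStateConjecture.FinalStateConjecture.Theorems.WindowedShellChannels.Negative.TravellingPacket

/-!
# `WindowedShellChannels` (crux stmt-FinalStateConjecture-14085, route `PhotonSphereChannels`):
# TWO-SIDEDNESS IN TIME is load-bearing — with only the forward (or only the backward) channel the
# statement is FALSE at every lag and constant (negative-side support, refuter cdisprove seat)

`WindowedShellChannels` bounds `c · E_total` by the SUM of the forward and the backward lagged
channel energies `liminf_{t→+∞} E[ψ; {ρ − h + |t| < |x − xc|}] + liminf_{t→−∞} (same)`.
Here we record, sorry-free, that neither summand can be dropped, whatever the lag `h ≥ 0`: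

* `forward_channel_fails` / `backward_channel_fails` — for every `h ≥ 0`, `c > 0` a global `C²`
  Regge–Wheeler solution (mass `1`, `xc = 0`, `s = ℓ = 0`) with data vanishing on the closed shell
  `{|x| ≤ 1}` violating `c · E_total(0) ≤ E⁺(1 − h)` (the travelling packet of
  `TravellingPacket.lean` plus the lagged-aperture monotonicity of `LaggedApertures.lean`), resp.
  `≤ E⁻(1 − h)` (its time reversal `ψ(−t, x)`).
* `windowedShellChannels_const_le_one` — TIGHTNESS: any `(h, c)` for which the inner statement of
  the crux holds at `M = ρ = 1` has `c ≤ 1` (`lost⁺ + lost⁻ ≥ (1 − ε)E_total` is attained).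
* `windowedShellChannels_false_without_backwardChannel`,
  `windowedShellChannels_false_without_forwardChannel` — hence the crux with the `atBot` (resp.
  `atTop`) summand deleted (stated inline; no proposition is defined under `Summits/`) is false.

Moral for provers: incoming radiation is lost forward and caught only backward (and vice versa);
any proof of `WindowedShellChannels` must let the two time directions COMPENSATE each other — a
one-ended-in-time estimate, however lagged, is false already for the `ℓ = 0` scalar mode at
`M = ρ = 1`.  Companion of `FalseWithoutLag.lean` (the lag is load-bearing, p78857).  This file
does NOT refute the crux.
-/

noncomputable section

set_option linter.dupNamespace false

namespace Summit.FinalStateConjecture.FinalStateConjecture.Theorems.WindowedShellChannels.Negative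

open Literature.Geometry.Lorentzian Literature.Geometry.Lorentzian.ReggeWheeler
open Summit.FinalStateConjecture.FinalStateConjecture.Theorems.Blindness
open Summit.FinalStateConjecture.FinalStateConjecture.Theorems.FrozenPacket
open Summit.FinalStateConjecture.FinalStateConjecture.Theorems.CauchyWave
open MeasureTheory Filter Set Function
open scoped ENNReal Topology

/-! ### One-ended channels fail -/

/-- **The forward channel alone fails**: for every `h ≥ 0` and `c > 0` there are (mass `1`,
`xc = 0`, `s = ℓ = 0`) a tortoise radius function and a global `C²` Regge–Wheeler solution with
data vanishing on the closed shell `{|x| ≤ 1}` for which `c · E_total(0) ≤ E⁺(1 − h)` is false. -/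
theorem forward_channel_fails {h : ℝ} (hh : 0 ≤ h) {c : ℝ} (hc : 0 < c) :
    ∃ (r : ℝ → ℝ) (ψ : ℝ → ℝ → ℝ), IsTortoiseRadius 1 r 0 ∧ IsRWSolution 1 0 0 r ψ ∧
      CauchyDataSupportedOn ψ {x : ℝ | 1 < |x - 0|} ∧
      ¬ (ENNReal.ofReal c * totalEnergy (linePotential 1 0 0 r) ψ 0 ≤
          channelEnergy (linePotential 1 0 0 r) 0 (1 - h) ψ atTop) := by
  set r : ℝ → ℝ := tortoiseRadius one_pos 0 with hr_def
  have hr : IsTortoiseRadius 1 r 0 := isTortoiseRadius_tortoiseRadius one_pos 0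
  have hε : 0 < c / 2 := by positivity
  obtain ⟨ψ, hψ, hdata, -, E₁, hE₁, hE, T, hT0, haT, hext⟩ := travelling_packet hr hh hε
  refine ⟨r, ψ, hr, hψ, hdata, fun hCI => ?_⟩
  have hVd : Differentiable ℝ (linePotential 1 0 0 r) := RW.differentiable_linePotential hr 0 0
  have hVnn : ∀ x, 0 ≤ linePotential 1 0 0 r x := fun x =>
    linePotential_nonneg zero_le_one (le_refl 0) hr.two_mul_lt x
  have hchan := channelEnergy_atTop_le_exteriorEnergy hVd hVnn hψ 0 (1 - h) hT0 haT
  have key : ENNReal.ofReal (c * E₁) ≤ ENNReal.ofReal (c / 2 * E₁) := by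
    calc ENNReal.ofReal (c * E₁) = ENNReal.ofReal c * ENNReal.ofReal E₁ := ENNReal.ofReal_mul hc.le
      _ ≤ ENNReal.ofReal c * totalEnergy (linePotential 1 0 0 r) ψ 0 := by gcongr
      _ ≤ _ := hCI
      _ ≤ _ := hchan
      _ ≤ ENNReal.ofReal (c / 2 * E₁) := hext
  have key' := (ENNReal.ofReal_le_ofReal_iff (by positivity)).1 key
  nlinarith

/-- **The backward channel alone fails** (time reversal of `forward_channel_fails`): for every
`h ≥ 0` and `c > 0` there is a global `C²` Regge–Wheeler solution (mass `1`, `xc = 0`,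
`s = ℓ = 0`) with data vanishing on `{|x| ≤ 1}` for which `c · E_total(0) ≤ E⁻(1 − h)` fails. -/
theorem backward_channel_fails {h : ℝ} (hh : 0 ≤ h) {c : ℝ} (hc : 0 < c) :
    ∃ (r : ℝ → ℝ) (ψ : ℝ → ℝ → ℝ), IsTortoiseRadius 1 r 0 ∧ IsRWSolution 1 0 0 r ψ ∧
      CauchyDataSupportedOn ψ {x : ℝ | 1 < |x - 0|} ∧
      ¬ (ENNReal.ofReal c * totalEnergy (linePotential 1 0 0 r) ψ 0 ≤
          channelEnergy (linePotential 1 0 0 r) 0 (1 - h) ψ atBot) := by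
  set r : ℝ → ℝ := tortoiseRadius one_pos 0 with hr_def
  have hr : IsTortoiseRadius 1 r 0 := isTortoiseRadius_tortoiseRadius one_pos 0
  have hε : 0 < c / 2 := by positivity
  obtain ⟨ψ, hψ, hdata, -, E₁, hE₁, hE, T, hT0, haT, hext⟩ := travelling_packet hr hh hε
  set V := linePotential 1 0 0 r with hV
  have hVd : Differentiable ℝ V := RW.differentiable_linePotential hr 0 0
  have hVnn : ∀ x, 0 ≤ V x := fun x => linePotential_nonneg zero_le_one (le_refl 0) hr.two_mul_lt x
  -- the time-reversed solution `χ(t, x) = ψ(−t, x)`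
  set χ : ℝ → ℝ → ℝ := fun t x => ψ (-t) x with hχ
  have hχ2 : ContDiff ℝ 2 (uncurry χ) :=
    hψ.1.comp ((contDiff_neg.comp contDiff_fst).prodMk contDiff_snd)
  have hχsol : IsRWSolution 1 0 0 r χ := by
    refine ⟨hχ2, fun z => ?_⟩
    have h1 : iteratedDeriv 2 (fun τ => χ τ z.2) z.1 = iteratedDeriv 2 (fun τ => ψ τ z.2) (-z.1) := by
      show iteratedDeriv 2 (fun τ => ψ (-τ) z.2) z.1 = _
      rw [iteratedDeriv_comp_neg 2 (fun τ => ψ τ z.2) z.1]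
      norm_num
    show iteratedDeriv 2 (fun τ => χ τ z.2) z.1 - iteratedDeriv 2 (ψ (-z.1)) z.2
      + V z.2 * ψ (-z.1) z.2 = 0
    rw [h1]
    exact hψ.2 (-z.1, z.2)
  have hdens : ∀ t x, energyDensity V χ t x = energyDensity V ψ (-t) x := by
    intro t x
    show deriv (fun τ => ψ (-τ) x) t ^ 2 + deriv (ψ (-t)) x ^ 2 + V x * ψ (-t) x ^ 2
      = deriv (fun τ => ψ τ x) (-t) ^ 2 + deriv (ψ (-t)) x ^ 2 + V x * ψ (-t) x ^ 2
    rw [deriv_comp_neg (fun τ => ψ τ x) t]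
    ring
  have hext' : ∀ s, exteriorEnergy V 0 (1 - h) χ s = exteriorEnergy V 0 (1 - h) ψ (-s) := by
    intro s
    unfold exteriorEnergy
    simp_rw [hdens, abs_neg]
  have htot : totalEnergy V χ 0 = totalEnergy V ψ 0 := by
    unfold totalEnergy
    simp_rw [hdens, neg_zero]
  have hdataχ : CauchyDataSupportedOn χ {x : ℝ | 1 < |x - 0|} := by
    intro x hx
    obtain ⟨h0, h1⟩ := hdata x hx
    refine ⟨by simpa [hχ] using h0, ?_⟩
    show deriv (fun τ => ψ (-τ) x) 0 = 0
    rw [deriv_comp_neg (fun τ => ψ τ x) 0, neg_zero, h1, neg_zero]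
  refine ⟨r, χ, hr, hχsol, hdataχ, fun hCI => ?_⟩
  have hchan : channelEnergy V 0 (1 - h) χ atBot ≤ ENNReal.ofReal (c / 2 * E₁) := by
    unfold channelEnergy
    refine liminf_le_of_frequently_le' (Eventually.frequently ?_)
    filter_upwards [eventually_le_atBot (-T)] with s hs
    rw [hext' s]
    have hs' : T ≤ -s := by linarith
    exact (exteriorEnergy_antitone_of_nonneg_edge hVd hVnn hψ 0 (1 - h) hT0 hs' haT).trans hext
  have key : ENNReal.ofReal (c * E₁) ≤ ENNReal.ofReal (c / 2 * E₁) := by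
    calc ENNReal.ofReal (c * E₁) = ENNReal.ofReal c * ENNReal.ofReal E₁ := ENNReal.ofReal_mul hc.le
      _ ≤ ENNReal.ofReal c * totalEnergy V ψ 0 := by gcongr
      _ = ENNReal.ofReal c * totalEnergy V χ 0 := by rw [htot]
      _ ≤ _ := hCI
      _ ≤ ENNReal.ofReal (c / 2 * E₁) := hchan
  have key' := (ENNReal.ofReal_le_ofReal_iff (by positivity)).1 key
  nlinarith


/-! ### Tightness: the constant never exceeds one -/

/-- **Tightness of the constant.** If a lag `h ≥ 0` and a constant `c` satisfy the inner statement
of `WindowedShellChannels` at `M = ρ = 1` (for all tortoise radius functions, spins, angular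
numbers and shell-supported solutions), then `c ≤ 1`: the travelling packet of
`TravellingPacket.lean` has `E⁺(1 − h) ≤ ε E_total` while always `E⁻ ≤ E_total`, so
`lost⁺ + lost⁻ ≥ (1 − ε) E_total` is attained — at best ONE of the two time directions catches the
energy; no `c(M, ρ) > 1` can ever be proved. -/
theorem windowedShellChannels_const_le_one {h c : ℝ} (hh : 0 ≤ h)
    (H : ∀ (r : ℝ → ℝ) (xc : ℝ), IsTortoiseRadius 1 r xc → ∀ (s ℓ : ℕ), s ≤ 2 → s ≤ ℓ →
      ∀ ψ : ℝ → ℝ → ℝ, IsRWSolution 1 s ℓ r ψ → CauchyDataSupportedOn ψ {x : ℝ | 1 < |x - xc|} →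
      ENNReal.ofReal c * totalEnergy (linePotential 1 s ℓ r) ψ 0 ≤
        channelEnergy (linePotential 1 s ℓ r) xc (1 - h) ψ atTop +
          channelEnergy (linePotential 1 s ℓ r) xc (1 - h) ψ atBot) : c ≤ 1 := by
  by_contra hc1
  push Not at hc1
  set r : ℝ → ℝ := tortoiseRadius one_pos 0 with hr_def
  have hr : IsTortoiseRadius 1 r 0 := isTortoiseRadius_tortoiseRadius one_pos 0
  have hε : 0 < (c - 1) / 2 := by linarith
  obtain ⟨ψ, hψ, hdata, ⟨a, b, hab, hdataI⟩, E₁, hE₁, hE, T, hT0, haT, hext⟩ :=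
    travelling_packet hr hh hε
  set V := linePotential 1 0 0 r with hV
  have hVd : Differentiable ℝ V := RW.differentiable_linePotential hr 0 0
  have hVnn : ∀ x, 0 ≤ V x := fun x => linePotential_nonneg zero_le_one (le_refl 0) hr.two_mul_lt x
  -- the total energy is finite and conserved
  have hcons : ∀ t, totalEnergy V ψ t = totalEnergy V ψ 0 := fun t => by
    rw [hV, RW.totalEnergy_eq_rw hr (le_refl 0) hψ hab hdataI t,
      RW.totalEnergy_eq_rw hr (le_refl 0) hψ hab hdataI 0]
  set E := totalEnergy V ψ 0 with hEdef
  have hEfin : E ≠ ⊤ := by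
    rw [hEdef, hV, RW.totalEnergy_eq_rw hr (le_refl 0) hψ hab hdataI 0]
    exact ENNReal.ofReal_ne_top
  -- forward: the travelling packet; backward: never more than the total energy
  have hplus : channelEnergy V 0 (1 - h) ψ atTop ≤ ENNReal.ofReal ((c - 1) / 2 * E₁) :=
    (channelEnergy_atTop_le_exteriorEnergy hVd hVnn hψ 0 (1 - h) hT0 haT).trans hext
  have hminus : channelEnergy V 0 (1 - h) ψ atBot ≤ E := by
    unfold channelEnergy
    refine liminf_le_of_frequently_le' (Eventually.frequently (Eventually.of_forall fun t => ?_))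
    exact (exteriorEnergy_le_totalEnergy V 0 (1 - h) ψ t).trans_eq ((hcons t).trans hEdef)
  have key : ENNReal.ofReal c * E ≤ ENNReal.ofReal ((c - 1) / 2 * E₁) + E :=
    (H r 0 hr 0 0 (Nat.zero_le _) le_rfl ψ hψ hdata).trans (add_le_add hplus hminus)
  -- in real numbers
  set e : ℝ := E.toReal with he
  have hEe : E = ENNReal.ofReal e := (ENNReal.ofReal_toReal hEfin).symm
  have he0 : 0 ≤ e := ENNReal.toReal_nonneg
  have he1 : E₁ ≤ e := by
    have h1 := hE
    rw [hEe] at h1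
    exact (ENNReal.ofReal_le_ofReal_iff he0).1 h1
  rw [hEe] at key
  have key2 : ENNReal.ofReal (c * e) ≤ ENNReal.ofReal ((c - 1) / 2 * E₁ + e) := by
    calc ENNReal.ofReal (c * e) = ENNReal.ofReal c * ENNReal.ofReal e :=
          ENNReal.ofReal_mul (by linarith)
      _ ≤ ENNReal.ofReal ((c - 1) / 2 * E₁) + ENNReal.ofReal e := key
      _ = ENNReal.ofReal ((c - 1) / 2 * E₁ + e) := (ENNReal.ofReal_add (by positivity) he0).symm
  have key3 := (ENNReal.ofReal_le_ofReal_iff (by positivity)).1 key2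
  nlinarith [mul_pos (show 0 < c - 1 by linarith) hE₁]

/-! ### The one-ended specialisations of the crux are false -/

/-- **`WindowedShellChannels` with the backward channel deleted is false**: there are no
`h = h(M, ρ) ≥ 0`, `c = c(M, ρ) > 0` with `c · E_total(0) ≤ liminf_{t → +∞} E[ψ; {ρ − h + |t| <
|x − xc|}]` for all shell-supported Regge–Wheeler data — already at `M = ρ = 1`, `s = ℓ = 0`, by
`forward_channel_fails` (a packet travelling towards the shell from deep on the horizon side enters
the lagged ball and stays there).  The proposition negated is the crux with the summand
`+ channelEnergy … atBot` deleted (everything else verbatim). -/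
theorem windowedShellChannels_false_without_backwardChannel :
    ¬ (∀ M : ℝ, 0 < M → ∀ ρ : ℝ, 0 < ρ → ∃ h : ℝ, 0 ≤ h ∧ ∃ c : ℝ, 0 < c ∧ ∀ (r : ℝ → ℝ) (xc : ℝ),
        IsTortoiseRadius M r xc → ∀ (s ℓ : ℕ), s ≤ 2 → s ≤ ℓ → ∀ ψ : ℝ → ℝ → ℝ,
        IsRWSolution M s ℓ r ψ → CauchyDataSupportedOn ψ {x : ℝ | ρ < |x - xc|} →
        ENNReal.ofReal c * totalEnergy (linePotential M s ℓ r) ψ 0 ≤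
          channelEnergy (linePotential M s ℓ r) xc (ρ - h) ψ atTop) := by
  intro hK
  obtain ⟨h, hh, c, hc, H⟩ := hK 1 one_pos 1 one_pos
  obtain ⟨r, ψ, hr, hψ, hdata, hfail⟩ := forward_channel_fails hh hc
  exact hfail (H r 0 hr 0 0 (Nat.zero_le _) le_rfl ψ hψ hdata)

/-- **`WindowedShellChannels` with the forward channel deleted is false** (time reversal):
no `h ≥ 0`, `c > 0` give `c · E_total(0) ≤ liminf_{t → −∞} E[ψ; {ρ − h + |t| < |x − xc|}]` for
all shell-supported data, by `backward_channel_fails`.  The proposition negated is the crux with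
the summand `channelEnergy … atTop +` deleted (everything else verbatim). -/
theorem windowedShellChannels_false_without_forwardChannel :
    ¬ (∀ M : ℝ, 0 < M → ∀ ρ : ℝ, 0 < ρ → ∃ h : ℝ, 0 ≤ h ∧ ∃ c : ℝ, 0 < c ∧ ∀ (r : ℝ → ℝ) (xc : ℝ),
        IsTortoiseRadius M r xc → ∀ (s ℓ : ℕ), s ≤ 2 → s ≤ ℓ → ∀ ψ : ℝ → ℝ → ℝ,
        IsRWSolution M s ℓ r ψ → CauchyDataSupportedOn ψ {x : ℝ | ρ < |x - xc|} →
        ENNReal.ofReal c * totalEnergy (linePotential M s ℓ r) ψ 0 ≤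
          channelEnergy (linePotential M s ℓ r) xc (ρ - h) ψ atBot) := by
  intro hK
  obtain ⟨h, hh, c, hc, H⟩ := hK 1 one_pos 1 one_pos
  obtain ⟨r, ψ, hr, hψ, hdata, hfail⟩ := backward_channel_fails hh hc
  exact hfail (H r 0 hr 0 0 (Nat.zero_le _) le_rfl ψ hψ hdata)

end Summit.FinalStateConjecture.FinalStateConjecture.Theorems.WindowedShellChannels.Negative

end
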